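import Literature.AlgebraicGeometry.VanGeemen1994.WeilTypeHodgeGroupSUCentre
import HarnessLib

/-!
# `LINK′` holds — discharge of the named statement `HasSemisimpleHodgeGroup_of_hasHodgeGroupSU_weilType_statement`

Topic: `Literature/AlgebraicGeometry/HodgeTheory`. PROOF (by name, one line) of the typed statement
`HodgeTheory.HasSemisimpleHodgeGroup_of_hasHodgeGroupSU_weilType_statement` recorded as an unproved
`Prop` in `HodgeTheory/HodgeGroupProductSemisimpleCMFactor` (the re-typing `LINK′`, 2026-08-21, of the
link "special Mumford–Tate group `= SU_H` ⟹ Hodge group semisimple" for an abelian variety of Weil type: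
`dim A = 2n`, `0 < n`, `φ ≫ φ = -d`, `0 < d`, `h_K = d • e^*a + φ^* e^*a`).

The mathematics is NOT in this file: the theorem
`VanGeemen1994.hasSemisimpleHodgeGroup_of_hasHodgeGroupSU_weilType`
(`Literature/AlgebraicGeometry/VanGeemen1994/WeilTypeHodgeGroupSUCentre.lean`, written by a literature
seat of the sibling cell `pub-hodgecm2`, Hodge ladder stage 2) has exactly that statement as its type —
`H¹ = W ⊕ W̄`, `SU_H(ℂ) ≅ SL(W) ≅ SL_{2n}(ℂ)` (van Geemen, LNM 1594, Lemma 6.10), whose centre `μ_{2n}` is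
finite (Gordon 1999, 1.5.1–1.5.2), and `Hg(A)` acts faithfully on `H¹`. This leaf only records the
discharge under the fact's own name (`<fact>_holds`), so that consumers of the cell `pub-hodge-ring2`
(research route conditional on HC_CM; not a corollary; Q11.4-sentence-2 already refuted in dim ≥ 3) can
quote the Weil-type row of `HodgeGroupProductSemisimpleCMFactor` / `HodgeGroupProductCMFactorDiscOne`
with `LINK′` a theorem rather than a hypothesis. It is kept in a separate leaf because the proving file
imports `HodgeGroupProductSemisimpleCMFactor` itself (no import cycle). The first typing
`HasSemisimpleHodgeGroup_of_hasHodgeGroupSU_statement` (no Weil-type hypotheses) stays as typed and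
unproved — it is NOT discharged here and is not claimed.

Pure Literature: one theorem, no definition, no named fact, no `sorry`; axioms `propext`,
`Classical.choice`, `Quot.sound`.

## References

* B. van Geemen, *An introduction to the Hodge conjecture for abelian varieties*, LNM 1594 (1994),
  Lemma 6.10, Theorems 6.11–6.12.
* B. B. Gordon, *A survey of the Hodge conjecture for abelian varieties* (1999), 1.3, 1.5.1–1.5.2.
-/

namespace Literature.AlgebraicGeometry.HodgeTheory

/-- **`LINK′` holds**: for a complex abelian variety `A` of Weil type (`A.dim = 2 * n`, `0 < n`, an
endomorphism `φ` with `φ ≫ φ = -(d • 𝟙 A)`, `0 < d`, a projective embedding `e`, a rational class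
`a ≠ 0` on the ambient projective space, `h_K := d • e^*a + φ^* e^*a`), if the special Mumford–Tate group
is `SU_H` (`VanGeemen1994.HasHodgeGroupSU A φ n d h_K`) then the Hodge group of `A` is semisimple
(`HasSemisimpleHodgeGroup A`: finite centre). Proof: the theorem of
`VanGeemen1994/WeilTypeHodgeGroupSUCentre`, whose type is this statement verbatim (proved by the cell
`pub-hodgecm2`; recorded here by name only). [cite: vanGeemen1994HodgeAV, Lemma 6.10 and Thm. 6.12]
[cite: Gordon1999HodgeAVSurvey, 1.5.1 and 1.5.2 Examples] -/
theorem HasSemisimpleHodgeGroup_of_hasHodgeGroupSU_weilType_statement_holds :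
    HasSemisimpleHodgeGroup_of_hasHodgeGroupSU_weilType_statement :=
  VanGeemen1994.hasSemisimpleHodgeGroup_of_hasHodgeGroupSU_weilType

end Literature.AlgebraicGeometry.HodgeTheory
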